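import Summits.AnomalousDissipation.AnomalousDissipation.Theorems.BaireTransferRobustLoudUpgradeStubLsFamilyB
import Summits.AnomalousDissipation.AnomalousDissipation.Theorems.BaireTransferRobustLoudUpgradeStubLsTransfer

/-!
# Stub `stub_radialIsUnfolding` of the line `malkin-cone-group-orbits` (crux stmt-AnomalousDissipation-1144, companion c5
# "the intrinsic unfolding"): the radially visible class R is contained in the intrinsically visible class U

Registered stub `stub_radialIsUnfolding` (Pi-form), proved here.  Let `u₀` be a mean-zero classical steady state of
`NS_ν(f_c)` (`ν > 0`) which is RADIALLY VISIBLE: the force itself is not in the range of the linearisation,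
`f_c ∉ range L(ν,u₀)`.  Then `u₀` is INTRINSICALLY VISIBLE with the border field `Δu₀`: `Δu₀ ∉ range L(ν,u₀)`.

Proof (linear algebra on the steady Fourier lattice).  Write `a = 𝓕u₀` (rapidly decaying, transversal, `a(0) = 0`),
`N` for the convective symbol and `Π` for the Leray multiplier.  The steady equation reads
`ν4π²|k|² a + Π N(a,a) = 𝓕f_c` (`SteadyLattice.fourier_eq_of_isSteadyNSState`), and a classical solution `w` of
`L(ν,u₀) w = Δu₀` reads `ν4π²|k|² ŵ + Π (N(a,ŵ) + N(ŵ,a)) = −Π 𝓕(Δu₀) = 4π²|k|² a`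
(`LsTransfer.latticeEq_of_linNSResolventRel`, `mFourierCoeff_complexify_laplacian`).  By bilinearity of `N`
(`SteadyLattice.nl_add_left/right`, `nl_smul_left/right`) the family `c' = −a/2 − (ν/2) ŵ` (rapidly decaying,
transversal, zero mode `0`) solves `ν4π²|k|² c' + Π (N(a,c') + N(c',a)) = −𝓕f_c`, i.e. — classically,
`L(ν,u₀)(−u₀/2 − (ν/2) w) = f_c` with pressure `−p₀ − (ν/2) q` — and the synthesis
`SteadyLattice.linNSResolventRel_of_fourier` turns `c'` into a classical solution of `L(ν,u₀) w' = f_c`,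
contradicting radial visibility.  Pure proof file.
References: Temam 1979 Ch. II §1; Constantin–Foias 1988 Ch. 7 (the linearisation); the route file (item 1144).
-/

-- `Summit.<Summit>.<Problem>` is the tree's mandated summit-side namespace (CONVENTIONS §2); for this
-- single-conjunct summit the two coincide, so the duplicate is deliberate.
set_option linter.dupNamespace false

noncomputable section

open scoped BigOperators Topology
open Filter Set Function TopologicalSpace MeasureTheory UnitAddTorus

namespace Summit.AnomalousDissipation.AnomalousDissipation.Theorems.RobustLoudUpgrade.RadialIsUnfolding

open Literature.Analysis.FunctionSpaces Literature.Analysis.FunctionSpaces.Torus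
open Literature.Analysis.FunctionSpaces.EuclideanSpace
open Literature.Analysis.FluidPDE
open Literature.Analysis.FluidPDE.ScalarFourier
open Literature.Analysis.FluidPDE.SteadyLattice
open Summit.AnomalousDissipation.AnomalousDissipation.Theses.BaireTransfer
open Summit.AnomalousDissipation.AnomalousDissipation.Theorems.RobustLoudUpgrade
open Summit.AnomalousDissipation.AnomalousDissipation.Theorems.RobustLoudUpgrade.SteadyPersist
open Summit.AnomalousDissipation.AnomalousDissipation.Theorems.RobustLoudUpgrade.LsFamily
open Summit.AnomalousDissipation.AnomalousDissipation.Theorems.RobustLoudUpgrade.LsTransfer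

/-! ## The registered stub -/

/-- **Registered stub `stub_radialIsUnfolding`** (class R ⊆ class U): for a mean-zero classical steady state `u₀`
of `NS_ν(f_c)`, radial visibility `f_c ∉ range L(ν,u₀)` implies intrinsic visibility `Δu₀ ∉ range L(ν,u₀)`
(from a classical solution `w` of `L w = Δu₀` the field `−u₀/2 − (ν/2) w` solves `L w' = f_c`; carried out on the
steady Fourier lattice, see the module docstring). [folklore] -/
theorem stub_radialIsUnfolding : ∀ (S : Finset (Fin 3 → ℤ)) (c : Coeff S) (ν : ℝ) (u₀ : UnitAddTorus (Fin 3) → EuclideanSpace ℝ (Fin 3)) (p₀ : UnitAddTorus (Fin 3) → ℝ), 0 < ν → Torus.IsSteadyNSState ν (force S c) u₀ p₀ → HasZeroMean u₀ → (∀ w, ¬ Torus.LinNSResolventRel ν u₀ 0 w (cplx (force S c))) → ∀ w, ¬ Torus.LinNSResolventRel ν u₀ 0 w (cplx (laplacian u₀)) := by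
  intro S c ν u₀ p₀ hν hst h0 hvis w hw
  -- §1 the steady state on the Fourier side
  have hu₀ : IsSmooth u₀ := hst.smooth_velocity.isSmooth_slice (Set.mem_univ 0)
  have hdiv₀ : IsDivFree u₀ := hst.divFree 0 (Set.mem_univ 0)
  have hcplx : ∀ u : UnitAddTorus (Fin 3) → EuclideanSpace ℝ (Fin 3), cplx u = complexify ∘ u := fun u => by
    funext y; simp only [cplx, Function.comp_apply, realToComplex_eq_complexify]
  set a : (Fin 3 → ℤ) → EuclideanSpace ℂ (Fin 3) := mFourierCoeff (complexify ∘ u₀) with ha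
  have har : RapidDecay a := hu₀.complexify_comp.rapidDecay_mFourierCoeff
  have ha0 : a 0 = 0 := mFourierCoeff_complexify_zero_of_hasZeroMean hu₀ h0
  have hat : ∀ m : Fin 3 → ℤ, (∑ jj : Fin 3, ((m jj : ℤ) : ℂ) * (a m) jj) = 0 := fun m =>
    hdiv₀.sum_mul_mFourierCoeff_eq_zero hu₀ m
  have hPa : ∀ k : Fin 3 → ℤ, Torus.lerayCoeff k (a k) = a k := fun k => lerayCoeff_coeff hu₀ hdiv₀ h0 k
  -- §2 the given classical solution `w` of `L(ν,u₀) w = Δu₀` on the Fourier side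
  set cw : (Fin 3 → ℤ) → EuclideanSpace ℂ (Fin 3) := mFourierCoeff w with hcw
  have hcwr : RapidDecay cw := hw.1.rapidDecay_mFourierCoeff
  have hcw0 : cw 0 = 0 := mFourierCoeff_zero_of_hasZeroMean hw.2.2.1
  have hcwt : ∀ k : Fin 3 → ℤ, (∑ jj : Fin 3, ((k jj : ℤ) : ℂ) * (cw k) jj) = 0 := fun k =>
    KolmogorovShear.kdot_mFourierCoeff_eq_zero hw.1 hw.2.1 k
  -- §3 the corrected family `c' = -a/2 - (ν/2) ŵ`
  set c₂ : ℂ := -((ν : ℂ) / 2) with hc₂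
  set c' : (Fin 3 → ℤ) → EuclideanSpace ℂ (Fin 3) := (-(1 / 2 : ℂ)) • a + c₂ • cw with hc'
  have hc'r : RapidDecay c' := (har.const_smul _).add (hcwr.const_smul _)
  have hc't : ∀ k : Fin 3 → ℤ, (∑ jj : Fin 3, ((k jj : ℤ) : ℂ) * (c' k) jj) = 0 := by
    intro k
    rw [hc', Pi.add_apply, Pi.smul_apply, Pi.smul_apply, kdot_add, kdot_smul, kdot_smul, hat k, hcwt k, mul_zero,
      mul_zero, add_zero]
  have hc'0 : c' 0 = 0 := by
    rw [hc', Pi.add_apply, Pi.smul_apply, Pi.smul_apply, ha0, hcw0, smul_zero, smul_zero, add_zero]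
  -- §4 the force `f_c` as a complex field
  have hgs : IsSmooth (cplx (force S c)) := by
    rw [hcplx]; exact (isSmooth_force' c).complexify_comp
  have hg0 : mFourierCoeff (cplx (force S c)) 0 = 0 := by
    rw [hcplx]; exact mFourierCoeff_complexify_zero_of_hasZeroMean (isSmooth_force' c) (hasZeroMean_force' c)
  -- §5 synthesis: `c'` solves the lattice equation with right-hand side `-𝓕f_c`, hence `f_c ∈ range L(ν,u₀)`
  refine hvis _ (Classical.choose_spec (linNSResolventRel_of_fourier (ν := ν) (g := cplx (force S c)) (c := c')
    hu₀ hdiv₀ hgs hg0 hc'r hc't hc'0 fun k => ?_)).1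
  -- the right-hand side `-Π 𝓕f_c = -𝓕f_c`
  rw [← ha, hcplx (force S c), lerayCoeff_forceCoeff]
  -- bilinearity of the symbol
  have hs : ∀ (x y : (Fin 3 → ℤ) → EuclideanSpace ℂ (Fin 3)), RapidDecay x → RapidDecay y →
      ∀ j p : Fin 3, Summable fun m => x m j * (dsym j (k - m) * y (k - m) p) := fun x y hx hy j p =>
    summable_nl_rapid hx hy k j p
  rw [hc', nl_add_right a ((-(1 / 2 : ℂ)) • a) (c₂ • cw) k (hs _ _ har (har.const_smul _))
      (hs _ _ har (hcwr.const_smul _)),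
    nl_add_left ((-(1 / 2 : ℂ)) • a) (c₂ • cw) a k (hs _ _ (har.const_smul _) har) (hs _ _ (hcwr.const_smul _) har),
    nl_smul_right, nl_smul_right, nl_smul_left, nl_smul_left]
  simp only [lerayCoeff_add', lerayCoeff_smul', Pi.add_apply, Pi.smul_apply]
  -- the steady equation `ν4π²|k|² a + Π N(a,a) = 𝓕f_c`
  have hS := fourier_eq_of_isSteadyNSState hst (isSmooth_force' c) h0 k
  rw [lerayCoeff_forceCoeff, ← ha] at hS
  -- the equation of `w`: `ν4π²|k|² ŵ + Π (N(a,ŵ) + N(ŵ,a)) = -Π 𝓕(Δu₀) = 4π²|k|² a`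
  have hW := latticeEq_of_linNSResolventRel hu₀ hw k
  rw [← ha, ← hcw, hcplx (laplacian u₀), mFourierCoeff_complexify_laplacian hu₀ k, ← ha, ← neg_smul,
    lerayCoeff_smul', hPa, lerayCoeff_add'] at hW
  push_cast at hS hW ⊢
  linear_combination (norm := module) c₂ • hW - hS

end Summit.AnomalousDissipation.AnomalousDissipation.Theorems.RobustLoudUpgrade.RadialIsUnfolding

end
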